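import Literature.Probability.Process.BrownianSupTail
import Literature.Probability.RandomPlanarGeometry.LocalMartingaleProofs
import HarnessLib

/-!
# The running supremum of Brownian motion on a short interval: tail and first moment

For the canonical Brownian motion `B` under the pre-Wiener measure and `h > 0` we package the
estimates on `[0, h]` used by one-step (`o(h)`) conditional-increment computations:

* `runSup h ω = sup_{s ≤ h} |B_s ω|`, a measurable random variable (countable dyadic sup, paths
  are continuous) dominating `|B_s|`, `s ≤ h` (`abs_brownian_le_runSup`);
* `measure_runSup_ge_le` — the `O(h²)` tail `P(runSup h ≥ a) ≤ 2h²/((a/2)² - h)²` for `(a/2)² > h`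
  (`measure_exists_le_abs_brownian_le`, Doob for `B² - t`);
* `integral_runSup_sq_le` — `E[(runSup h)²] ≤ 4h` (Doob's `L²` inequality
  `doob_lintegral_iSup_sq_le_of_continuous`), hence `integral_runSup_le` — `E[runSup h] ≤ 2√h`;
* moments of `B_h`: `E[B_h] = 0`, `E[|B_h|] ≤ √h`, `E[|B_h|³] ≤ √3 h^{3/2}` (Cauchy–Schwarz).

## References

* D. Revuz, M. Yor, *Continuous Martingales and Brownian Motion* (1999), Ch. II Thm (1.7)
  [RevuzYor1999].
-/

noncomputable section

open MeasureTheory ProbabilityTheory Filter Topology Set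
open scoped NNReal ENNReal

namespace Literature.Probability.Process

/-! ### Moments of `B_h` -/

/-- `E[B_h] = 0`. [folklore] -/
theorem integral_brownian_eq_zero (h : ℝ≥0) : ∫ ω, brownian h ω ∂preWienerMeasure = 0 :=
  RandomPlanarGeometry.isPreBrownianReal_brownian.integral_eval h

/-- `E[|B_h|] ≤ √h` (Cauchy–Schwarz). [folklore] -/
theorem integral_abs_brownian_le (h : ℝ≥0) : ∫ ω, |brownian h ω| ∂preWienerMeasure ≤ Real.sqrt h := by
  haveI := RandomPlanarGeometry.isProbabilityMeasure_preWienerMeasure'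
  have hH := integral_mul_le_Lp_mul_Lq_of_nonneg (μ := preWienerMeasure) Real.HolderConjugate.two_two
    (f := fun ω ↦ |brownian h ω|) (g := fun _ ↦ (1 : ℝ))
    (Eventually.of_forall fun ω ↦ abs_nonneg _) (Eventually.of_forall fun _ ↦ zero_le_one)
    (by rw [ENNReal.ofReal_ofNat]; exact (memLp_brownian h (p := 2) (by simp)).abs)
    (by rw [ENNReal.ofReal_ofNat]; exact memLp_const (1 : ℝ))
  have h2 : ∫ ω, |brownian h ω| ^ (2 : ℝ) ∂preWienerMeasure = h := by
    have : (fun ω ↦ |brownian h ω| ^ (2 : ℝ)) = fun ω ↦ brownian h ω ^ 2 := by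
      funext ω; rw [show (2 : ℝ) = (2 : ℕ) by norm_num, Real.rpow_natCast, sq_abs]
    rw [this, integral_brownian_sq]
  simp only [mul_one, Real.one_rpow, integral_const, probReal_univ, smul_eq_mul, h2] at hH
  rw [Real.sqrt_eq_rpow]
  refine hH.trans (le_of_eq ?_)
  norm_num

/-- `E[|B_h|³] ≤ √3 · h^{3/2}` (Cauchy–Schwarz with `E[B_h²] = h`, `E[B_h⁴] = 3h²`). [folklore] -/
theorem integral_abs_brownian_pow_three_le (h : ℝ≥0) :
    ∫ ω, |brownian h ω| ^ 3 ∂preWienerMeasure ≤ Real.sqrt 3 * (h : ℝ) ^ (3 / 2 : ℝ) := by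
  haveI := RandomPlanarGeometry.isProbabilityMeasure_preWienerMeasure'
  have hg : MemLp (fun ω ↦ brownian h ω ^ 2) (ENNReal.ofReal 2) preWienerMeasure := by
    have h1 := memLp_two_brownian_sub_sq 0 h
    simp only [brownian_zero, sub_zero] at h1
    rw [ENNReal.ofReal_ofNat]
    exact h1
  have hH := integral_mul_le_Lp_mul_Lq_of_nonneg (μ := preWienerMeasure) Real.HolderConjugate.two_two
    (f := fun ω ↦ |brownian h ω|) (g := fun ω ↦ brownian h ω ^ 2)
    (Eventually.of_forall fun ω ↦ abs_nonneg _) (Eventually.of_forall fun _ ↦ sq_nonneg _)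
    (by rw [ENNReal.ofReal_ofNat]; exact (memLp_brownian h (p := 2) (by simp)).abs) hg
  have hlhs : (fun ω ↦ |brownian h ω| * brownian h ω ^ 2) = fun ω ↦ |brownian h ω| ^ 3 := by
    funext ω; rw [← sq_abs]; ring
  rw [hlhs] at hH
  have h4 : ∫ ω, (brownian h ω ^ 2) ^ (2 : ℝ) ∂preWienerMeasure = 3 * (h : ℝ) ^ 2 := by
    have : (fun ω ↦ (brownian h ω ^ 2) ^ (2 : ℝ)) = fun ω ↦ brownian h ω ^ 4 := by
      funext ω; rw [show (2 : ℝ) = (2 : ℕ) by norm_num, Real.rpow_natCast]; ring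
    rw [this, integral_brownian_pow_four]
  have h2 : ∫ ω, |brownian h ω| ^ (2 : ℝ) ∂preWienerMeasure = h := by
    have : (fun ω ↦ |brownian h ω| ^ (2 : ℝ)) = fun ω ↦ brownian h ω ^ 2 := by
      funext ω; rw [show (2 : ℝ) = (2 : ℕ) by norm_num, Real.rpow_natCast, sq_abs]
    rw [this, integral_brownian_sq]
  rw [h4, h2] at hH
  refine hH.trans (le_of_eq ?_)
  -- `h^{1/2} (3 h²)^{1/2} = √3 h^{3/2}`
  have hh : (0 : ℝ) ≤ h := h.coe_nonneg
  rw [Real.mul_rpow (by norm_num) (by positivity), Real.sqrt_eq_rpow]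
  rw [show ((h : ℝ) ^ 2) ^ (1 / 2 : ℝ) = h by
    rw [← Real.rpow_natCast, ← Real.rpow_mul hh]; norm_num]
  rw [show (h : ℝ) ^ (3 / 2 : ℝ) = (h : ℝ) ^ (1 / 2 : ℝ) * h by
    rw [show (3 / 2 : ℝ) = 1 / 2 + 1 by norm_num, Real.rpow_add' hh (by norm_num), Real.rpow_one]]
  ring

/-! ### The running supremum -/

/-- The dyadic grid points `(k h / 2ⁿ) ∧ h`. [folklore] -/
def dyadTime (h : ℝ≥0) (n k : ℕ) : ℝ≥0 := min (h * ((k : ℝ≥0) / 2 ^ n)) h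

/-- Grid points are `≤ h`. [folklore] -/
theorem dyadTime_le (h : ℝ≥0) (n k : ℕ) : dyadTime h n k ≤ h := min_le_right _ _

/-- **The running supremum `sup_{s ≤ h} |B_s|`**, as the countable supremum over the dyadic grids
(equal to the supremum over `[0, h]` on continuous paths). [folklore] -/
def runSup (h : ℝ≥0) (ω : ℝ≥0 → ℝ) : ℝ :=
  ⨆ p : ℕ × ℕ, |brownian (dyadTime h p.1 p.2) ω|

/-- The family `|B_{grid}|` is bounded above (continuous path on `[0, h]`). [folklore] -/
theorem bddAbove_range_abs_brownian_dyad (h : ℝ≥0) (ω : ℝ≥0 → ℝ) :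
    BddAbove (Set.range fun p : ℕ × ℕ ↦ |brownian (dyadTime h p.1 p.2) ω|) := by
  obtain ⟨C, hC⟩ := isCompact_Icc.exists_bound_of_continuousOn (s := Set.Icc (0 : ℝ≥0) h)
    ((continuous_brownian ω).continuousOn)
  refine ⟨C, ?_⟩
  rintro _ ⟨p, rfl⟩
  have := hC (dyadTime h p.1 p.2) ⟨bot_le, dyadTime_le h p.1 p.2⟩
  rwa [Real.norm_eq_abs] at this

/-- `runSup` is measurable. [folklore] -/
theorem measurable_runSup (h : ℝ≥0) : Measurable (runSup h) :=
  Measurable.iSup fun _ ↦ (measurable_brownian _).abs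

/-- `0 ≤ runSup`. [folklore] -/
theorem runSup_nonneg (h : ℝ≥0) (ω : ℝ≥0 → ℝ) : 0 ≤ runSup h ω :=
  le_ciSup_of_le (bddAbove_range_abs_brownian_dyad h ω) (0, 0) (abs_nonneg _)

/-- Grid values are `≤ runSup`. [folklore] -/
theorem abs_brownian_dyad_le_runSup (h : ℝ≥0) (ω : ℝ≥0 → ℝ) (n k : ℕ) :
    |brownian (dyadTime h n k) ω| ≤ runSup h ω :=
  le_ciSup (bddAbove_range_abs_brownian_dyad h ω) (n, k)

/-- **`|B_s| ≤ runSup h` for all `s ≤ h`** (grid points approximate `s` from below; the path is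
continuous). [folklore] -/
theorem abs_brownian_le_runSup {h s : ℝ≥0} (hs : s ≤ h) (ω : ℝ≥0 → ℝ) : |brownian s ω| ≤ runSup h ω := by
  have hgrid := abs_brownian_dyad_le_runSup h ω
  rcases eq_or_ne h 0 with rfl | h0
  · have : s = 0 := le_antisymm hs bot_le
    subst this
    have := hgrid 0 0
    simp only [dyadTime, Nat.cast_zero, zero_div, mul_zero] at this
    simpa using this
  have hpos : (0 : ℝ) < h := lt_of_le_of_ne h.coe_nonneg (fun h' ↦ h0 (by exact_mod_cast h'.symm))
  -- the grid points `tₙ = (⌊s 2ⁿ / h⌋ h / 2ⁿ) ∧ h → s`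
  set k : ℕ → ℕ := fun n ↦ ⌊(s : ℝ) / h * 2 ^ n⌋₊ with hk
  have hbounds : ∀ n, (dyadTime h n (k n) : ℝ) ≤ s ∧ (s : ℝ) - h / 2 ^ n ≤ dyadTime h n (k n) := by
    intro n
    have hfl := Nat.floor_le (by positivity : (0 : ℝ) ≤ (s : ℝ) / h * 2 ^ n)
    have hfl' : (s : ℝ) / h * 2 ^ n < k n + 1 := Nat.lt_floor_add_one _
    have hval : ((h * ((k n : ℝ≥0) / 2 ^ n) : ℝ≥0) : ℝ) = h * (k n : ℝ) / 2 ^ n := by push_cast; ring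
    have hle : ((h * ((k n : ℝ≥0) / 2 ^ n) : ℝ≥0) : ℝ) ≤ s := by
      rw [hval, div_le_iff₀ (by positivity)]
      calc (h : ℝ) * (k n) ≤ h * ((s : ℝ) / h * 2 ^ n) := mul_le_mul_of_nonneg_left hfl h.coe_nonneg
        _ = s * 2 ^ n := by field_simp
    have hmin : dyadTime h n (k n) = h * ((k n : ℝ≥0) / 2 ^ n) := by
      rw [dyadTime, min_eq_left]
      exact_mod_cast hle.trans (by exact_mod_cast hs : (s : ℝ) ≤ h)
    refine ⟨by rw [hmin]; exact hle, ?_⟩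
    rw [hmin, hval, le_div_iff₀ (by positivity)]
    rw [div_mul_eq_mul_div, div_lt_iff₀ hpos] at hfl'
    have h2n : (0 : ℝ) < 2 ^ n := by positivity
    have : ((s : ℝ) - h / 2 ^ n) * 2 ^ n = s * 2 ^ n - h := by field_simp
    rw [this]
    nlinarith
  have hconv : Tendsto (fun n ↦ (dyadTime h n (k n) : ℝ)) atTop (𝓝 s) := by
    refine tendsto_of_tendsto_of_tendsto_of_le_of_le ?_ tendsto_const_nhds (fun n ↦ (hbounds n).2)
      (fun n ↦ (hbounds n).1)
    have h1 : Tendsto (fun n : ℕ ↦ (h : ℝ) / 2 ^ n) atTop (𝓝 0) := by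
      have := (tendsto_pow_atTop_nhds_zero_of_lt_one (r := (1 / 2 : ℝ)) (by norm_num) (by norm_num)).const_mul (h : ℝ)
      rw [mul_zero] at this
      refine this.congr fun n ↦ ?_
      rw [one_div, inv_pow, div_eq_mul_inv]
    simpa using tendsto_const_nhds.sub h1
  have hconv' : Tendsto (fun n ↦ dyadTime h n (k n)) atTop (𝓝 s) := NNReal.tendsto_coe.1 hconv
  have hcont : Tendsto (fun n ↦ |brownian (dyadTime h n (k n)) ω|) atTop (𝓝 |brownian s ω|) :=
    (((continuous_brownian ω).tendsto s).comp hconv').abs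
  exact le_of_tendsto' hcont fun n ↦ hgrid n (k n)

/-- **Tail of the running supremum**: `P(runSup h ≥ a) ≤ 2h²/((a/2)² - h)²` for `a ≥ 0` with
`(a/2)² > h` (if `runSup ≥ a` then some grid point has `|B| ≥ a/2`).
[cite: RevuzYor1999, Ch. II Thm (1.7)] -/
theorem measure_runSup_ge_le (h : ℝ≥0) {a : ℝ} (ha0 : 0 ≤ a) (ha : (h : ℝ) < (a / 2) ^ 2) :
    preWienerMeasure {ω | a ≤ runSup h ω} ≤ ENNReal.ofReal (2 * (h : ℝ) ^ 2 / ((a / 2) ^ 2 - h) ^ 2) := by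
  have hapos : 0 < a := lt_of_le_of_ne ha0 (by
    rintro rfl
    have : (0 : ℝ) ≤ h := h.coe_nonneg
    nlinarith)
  refine (measure_mono fun ω hω ↦ ?_).trans (measure_exists_le_abs_brownian_le h (by positivity : 0 ≤ a / 2) ha)
  have hω' : a ≤ runSup h ω := hω
  by_contra hnot
  simp only [Set.mem_setOf_eq, not_exists, not_and, not_le] at hnot
  have : runSup h ω ≤ a / 2 := ciSup_le fun p ↦ (hnot _ (dyadTime_le h p.1 p.2)).le
  linarith

/-- **`E[(runSup h)²] ≤ 4h`** (Doob's `L²` inequality for the martingale `B` on `[0, h]`).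
[cite: RevuzYor1999, Ch. II Thm (1.7)] -/
theorem integral_runSup_sq_le (h : ℝ≥0) : ∫ ω, runSup h ω ^ 2 ∂preWienerMeasure ≤ 4 * (h : ℝ) := by
  haveI := RandomPlanarGeometry.isProbabilityMeasure_preWienerMeasure'
  have hD := doob_lintegral_iSup_sq_le_of_continuous RandomPlanarGeometry.martingale_brownian_holds
    RandomPlanarGeometry.memLp_two_brownian (Eventually.of_forall continuous_brownian) h
  -- `ofReal (runSup² ω) ≤ ⨆_{s ≤ h} ofReal (B_s ω ²)` pointwise
  have hpt : ∀ ω, ENNReal.ofReal (runSup h ω ^ 2) ≤ ⨆ s ∈ Set.Iic h, ENNReal.ofReal (brownian s ω ^ 2) := by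
    intro ω
    have hbdd := bddAbove_range_abs_brownian_dyad h ω
    set F : ℝ → ℝ≥0∞ := fun x ↦ ENNReal.ofReal (max x 0 ^ 2) with hF
    have hFmono : Monotone F := fun x y hxy ↦ by
      simp only [hF]
      refine ENNReal.ofReal_le_ofReal (pow_le_pow_left₀ (le_max_right _ _) (max_le_max hxy le_rfl) 2)
    have hFcont : Continuous F := ENNReal.continuous_ofReal.comp ((continuous_id.max continuous_const).pow 2)
    have h1 := Monotone.map_ciSup_of_continuousAt (f := F) hFcont.continuousAt hFmono hbdd
    have hFrun : F (runSup h ω) = ENNReal.ofReal (runSup h ω ^ 2) := by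
      simp only [hF, max_eq_left (runSup_nonneg h ω)]
    rw [← hFrun, runSup, h1]
    refine iSup_le fun p ↦ ?_
    have hrw : F |brownian (dyadTime h p.1 p.2) ω| = ENNReal.ofReal (brownian (dyadTime h p.1 p.2) ω ^ 2) := by
      simp only [hF]
      rw [max_eq_left (abs_nonneg (brownian (dyadTime h p.1 p.2) ω)), sq_abs]
    rw [hrw]
    exact le_iSup₂_of_le (f := fun s (_ : s ∈ Set.Iic h) ↦ ENNReal.ofReal (brownian s ω ^ 2)) (dyadTime h p.1 p.2)
      (show dyadTime h p.1 p.2 ∈ Set.Iic h from dyadTime_le h p.1 p.2) le_rfl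
  -- integrate
  have hlin : ∫⁻ ω, ENNReal.ofReal (runSup h ω ^ 2) ∂preWienerMeasure ≤ 4 * ∫⁻ ω, ENNReal.ofReal (brownian h ω ^ 2) ∂preWienerMeasure :=
    (lintegral_mono hpt).trans hD
  have hB2 : ∫⁻ ω, ENNReal.ofReal (brownian h ω ^ 2) ∂preWienerMeasure = ENNReal.ofReal h := by
    rw [← ofReal_integral_eq_lintegral_ofReal (integrable_brownian_pow h 2) (Eventually.of_forall fun ω ↦ sq_nonneg _),
      integral_brownian_sq]
  rw [hB2] at hlin
  have hfin : ∫⁻ ω, ENNReal.ofReal (runSup h ω ^ 2) ∂preWienerMeasure ≠ ∞ :=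
    ne_top_of_le_ne_top (by simp [ENNReal.mul_ne_top]) hlin
  rw [integral_eq_lintegral_of_nonneg_ae (Eventually.of_forall fun ω ↦ sq_nonneg _)
    ((measurable_runSup h).pow_const 2).aestronglyMeasurable]
  have := ENNReal.toReal_mono (by simp [ENNReal.mul_ne_top] : 4 * ENNReal.ofReal (h : ℝ) ≠ ∞) hlin
  rwa [ENNReal.toReal_mul, ENNReal.toReal_ofReal h.coe_nonneg, ENNReal.toReal_ofNat] at this

/-- `(runSup h)²` is integrable. [folklore] -/
theorem integrable_runSup_sq (h : ℝ≥0) : Integrable (fun ω ↦ runSup h ω ^ 2) preWienerMeasure := by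
  haveI := RandomPlanarGeometry.isProbabilityMeasure_preWienerMeasure'
  have hD := doob_lintegral_iSup_sq_le_of_continuous RandomPlanarGeometry.martingale_brownian_holds
    RandomPlanarGeometry.memLp_two_brownian (Eventually.of_forall continuous_brownian) h
  refine ⟨((measurable_runSup h).pow_const 2).aestronglyMeasurable, ?_⟩
  rw [hasFiniteIntegral_iff_ofReal (Eventually.of_forall fun ω ↦ sq_nonneg _)]
  -- reuse the bound of the previous proof
  have hpt : ∀ ω, ENNReal.ofReal (runSup h ω ^ 2) ≤ ⨆ s ∈ Set.Iic h, ENNReal.ofReal (brownian s ω ^ 2) := by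
    intro ω
    have hbdd := bddAbove_range_abs_brownian_dyad h ω
    set F : ℝ → ℝ≥0∞ := fun x ↦ ENNReal.ofReal (max x 0 ^ 2) with hF
    have hFmono : Monotone F := fun x y hxy ↦ by
      simp only [hF]
      refine ENNReal.ofReal_le_ofReal (pow_le_pow_left₀ (le_max_right _ _) (max_le_max hxy le_rfl) 2)
    have hFcont : Continuous F := ENNReal.continuous_ofReal.comp ((continuous_id.max continuous_const).pow 2)
    have h1 := Monotone.map_ciSup_of_continuousAt (f := F) hFcont.continuousAt hFmono hbdd
    have hFrun : F (runSup h ω) = ENNReal.ofReal (runSup h ω ^ 2) := by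
      simp only [hF, max_eq_left (runSup_nonneg h ω)]
    rw [← hFrun, runSup, h1]
    refine iSup_le fun p ↦ ?_
    have hrw : F |brownian (dyadTime h p.1 p.2) ω| = ENNReal.ofReal (brownian (dyadTime h p.1 p.2) ω ^ 2) := by
      simp only [hF]
      rw [max_eq_left (abs_nonneg (brownian (dyadTime h p.1 p.2) ω)), sq_abs]
    rw [hrw]
    exact le_iSup₂_of_le (f := fun s (_ : s ∈ Set.Iic h) ↦ ENNReal.ofReal (brownian s ω ^ 2)) (dyadTime h p.1 p.2)
      (show dyadTime h p.1 p.2 ∈ Set.Iic h from dyadTime_le h p.1 p.2) le_rfl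
  have hB2 : ∫⁻ ω, ENNReal.ofReal (brownian h ω ^ 2) ∂preWienerMeasure = ENNReal.ofReal h := by
    rw [← ofReal_integral_eq_lintegral_ofReal (integrable_brownian_pow h 2) (Eventually.of_forall fun ω ↦ sq_nonneg _),
      integral_brownian_sq]
  calc ∫⁻ ω, ENNReal.ofReal (runSup h ω ^ 2) ∂preWienerMeasure ≤ 4 * ∫⁻ ω, ENNReal.ofReal (brownian h ω ^ 2) ∂preWienerMeasure :=
        (lintegral_mono hpt).trans hD
    _ < ∞ := by rw [hB2]; simp [ENNReal.mul_lt_top]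

/-- `runSup h` is integrable. [folklore] -/
theorem integrable_runSup (h : ℝ≥0) : Integrable (runSup h) preWienerMeasure := by
  haveI := RandomPlanarGeometry.isProbabilityMeasure_preWienerMeasure'
  refine (integrable_runSup_sq h).add (integrable_const 1) |>.mono' (measurable_runSup h).aestronglyMeasurable
    (Eventually.of_forall fun ω ↦ ?_)
  rw [Real.norm_of_nonneg (runSup_nonneg h ω), Pi.add_apply]
  nlinarith [runSup_nonneg h ω, sq_nonneg (runSup h ω - 1)]

/-- **`E[runSup h] ≤ 2√h`** (`x ≤ x²/(4√h) + √h` and `E[(runSup h)²] ≤ 4h`; for `h = 0` both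
sides vanish). [cite: RevuzYor1999, Ch. II Thm (1.7)] -/
theorem integral_runSup_le (h : ℝ≥0) : ∫ ω, runSup h ω ∂preWienerMeasure ≤ 2 * Real.sqrt h := by
  haveI := RandomPlanarGeometry.isProbabilityMeasure_preWienerMeasure'
  rcases eq_or_ne h 0 with rfl | h0
  · -- `runSup 0 = |B_0| = 0`
    have : ∀ ω, runSup 0 ω = 0 := fun ω ↦ by
      refine le_antisymm (ciSup_le fun p ↦ ?_) (runSup_nonneg 0 ω)
      simp [dyadTime, brownian_zero]
    simp [this]
  have hpos : (0 : ℝ) < h := lt_of_le_of_ne h.coe_nonneg (fun h' ↦ h0 (by exact_mod_cast h'.symm))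
  have hsq : 0 < Real.sqrt h := Real.sqrt_pos.2 hpos
  -- pointwise AM–GM
  have hpt : ∀ ω, runSup h ω ≤ runSup h ω ^ 2 / (4 * Real.sqrt h) + Real.sqrt h := fun ω ↦ by
    rw [div_add' _ _ _ (by positivity), le_div_iff₀ (by positivity)]
    have := Real.mul_self_sqrt h.coe_nonneg
    nlinarith [sq_nonneg (runSup h ω - 2 * Real.sqrt h)]
  calc ∫ ω, runSup h ω ∂preWienerMeasure
      ≤ ∫ ω, (runSup h ω ^ 2 / (4 * Real.sqrt h) + Real.sqrt h) ∂preWienerMeasure :=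
        integral_mono (integrable_runSup h) (((integrable_runSup_sq h).div_const _).add (integrable_const _)) hpt
    _ = (∫ ω, runSup h ω ^ 2 ∂preWienerMeasure) / (4 * Real.sqrt h) + Real.sqrt h := by
        rw [integral_add ((integrable_runSup_sq h).div_const _) (integrable_const _), integral_div, integral_const]
        simp
    _ ≤ 4 * h / (4 * Real.sqrt h) + Real.sqrt h := by gcongr; exact integral_runSup_sq_le h
    _ = 2 * Real.sqrt h := by
        have := Real.mul_self_sqrt h.coe_nonneg
        field_simp
        nlinarith

end Literature.Probability.Process
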